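import Literature.MathematicalPhysics.QuantumFieldTheory.Balaban1983to89.FlowStepRuns

/-!
# Beta/Drift — the DRIFT form of the one-loop input behind [Balaban1987RG1] Theorem 2 (bookkeeping; β sub-cell row an1)

HONEST FRAMING (cell `pub-balaban`, BETA-SPEC): discharging the flow-side hypothesis of Bałaban's Theorem 2 would make
the ultraviolet STABILITY of four-dimensional lattice gauge theories unconditional — a constructive-QFT statement; it
is NOT the continuum limit and NOT the Clay problem.  This module asserts NOTHING about Bałaban's actual β-functions:
every `def … : Prop` below is a HYPOTHESIS SHAPE (never used as a fact), every theorem is elementary real arithmetic.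

Printed context.  [Balaban1987RG1] (CMP 109 (1987) 249) writes the effective density after k steps as (1.3), p. 260,
with the running coupling `g_k` and the one-loop normalisation factors `log Z^{(j)}(U_k)`, (1.4); the β-function of the
(k+1)-st step is defined by (1.20)–(1.22), p. 264, and splits as `β_{k+1}(g_0,…,g_k) = β⁰_{k+1} + β¹_{k+1}(g_0,…,g_k)`
along (2.12)–(2.14), p. 268 (tree `B12Beta.OneLoopSplit`).  Theorem 2, p. 259, first sentence, verbatim: «Let
d = 4, G = SU(2), and let γ be a sufficiently small positive constant, then for a sufficiently small positive g there
exists a bare coupling constant g₀ = g₀(ε, g) such that the sequence of the effective coupling constants g_k is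
contained in the interval ]0, γ], and g_K = g.» (existence of g₀ — no uniqueness is printed; the g_k are «generated from
the bare coupling constant g₀ by the renormalization group equations (0.18), (0.20)», p. 259 above Theorem 1).  The tree
reduces that sentence (and the [Balaban1989LargeFieldII] p. 355
reading) to the hypothesis `FlowStepRuns.BetaPartialSumsLowerH M γ β` — partial sums of the β's along `]0,γ]`-histories
bounded below (`FlowStepRuns.endpointExistence_of_partialSums`, `p355Unconditional_of_partialSums`) — and §10 of
`FlowStepRuns` derives it from the LIMIT form `|β⁰_{k+1} − β⁰_∞| ≤ c₀θ^k`, `Cγ ≤ β⁰_∞`.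

What this module adds (cell HOME/BETA/AN1.md §7).  The partial-sum hypothesis follows from a strictly WEAKER one-loop
input, the DRIFT form `OneLoopDrift b A β⁰`: `|Σ_{j<k} β⁰_{j+1} − b·k| ≤ A` for all k — "the marginal coefficient of the
COMPOSED one-loop functional grows like b·(number of scales) + O(1)".  It does not require `lim_k β⁰_{k+1}` to exist
and tolerates infinitely many individual sign failures.  `drift_of_geometric` records that the limit form is a special
case (`b = β⁰_∞`, `A = c₀/(1−θ)`), so §10 of `FlowStepRuns` factors through this module.  Whether Bałaban's one-loop
coefficients satisfy either form is an OPEN, located, unprinted question (cell MISSING-B12.md (M1)/(M2), AN1.md §7–§8).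

v1.1 (DOCFIX, docstring-only; declarations byte-identical to v1 p177564): the Theorem 2 quotation above replaced by the
printed sentence verbatim — v1 had put a paraphrase containing the unprinted word «unique» inside quotation marks
(cross-read b2b-balaban-pv13-g2, cell GAPS G-pv13g2-3).
-/

namespace Literature.MathematicalPhysics.QuantumFieldTheory.Balaban1983to89.Beta.Drift

open Literature.MathematicalPhysics.QuantumFieldTheory.Balaban1983to89
open FlowStep FlowStepRuns DagBinding

/-- HYPOTHESIS SHAPE (the drift form of the one-loop input; a predicate, never a fact): the partial sums of a sequence
of one-loop coefficients `β0 0, β0 1, …` stay within `A` of the straight line `b·k`: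
`∀ k, |Σ_{j<k} β0 j − b k| ≤ A`.  For Bałaban's `β⁰_{k+1}` this is the cell's statement (T-drift) of HOME/BETA/AN1.md §7,
located as NOT in print. [cite: Balaban1987RG1, (1.3) p.260 and (1.22) p.264] -/
def OneLoopDrift (b A : ℝ) (β0 : ℕ → ℝ) : Prop :=
  ∀ k : ℕ, |∑ j ∈ Finset.range k, β0 j - b * k| ≤ A

/-- A drift hypothesis forces `0 ≤ A` (take `k = 0`). [folklore] -/
theorem OneLoopDrift.nonneg {b A : ℝ} {β0 : ℕ → ℝ} (h : OneLoopDrift b A β0) : 0 ≤ A := by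
  have h0 := h 0
  simp at h0
  exact h0

/-- Two-sided control of every window sum under a drift hypothesis:
`|Σ_{j∈[k,n)} β0 j − b (n − k)| ≤ 2A`. [folklore] -/
theorem abs_sum_Ico_sub_le_of_drift {b A : ℝ} {β0 : ℕ → ℝ} (h : OneLoopDrift b A β0) {k n : ℕ} (hkn : k ≤ n) :
    |∑ j ∈ Finset.Ico k n, β0 j - b * ((n : ℝ) - k)| ≤ 2 * A := by
  have hn := abs_le.mp (h n)
  have hk := abs_le.mp (h k)
  rw [Finset.sum_Ico_eq_sub _ hkn, abs_le]
  constructor <;> nlinarith [hn.1, hn.2, hk.1, hk.2]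

/-- Lower bound on window sums under a drift hypothesis: `b (n − k) − 2A ≤ Σ_{j∈[k,n)} β0 j`. [folklore] -/
theorem sum_Ico_ge_of_drift {b A : ℝ} {β0 : ℕ → ℝ} (h : OneLoopDrift b A β0) {k n : ℕ} (hkn : k ≤ n) :
    b * ((n : ℝ) - k) - 2 * A ≤ ∑ j ∈ Finset.Ico k n, β0 j := by
  have := (abs_le.mp (abs_sum_Ico_sub_le_of_drift h hkn)).1
  linarith

/-- **(A-ps) from the drift form.**  If `β` splits as `β⁰ + β¹` (`B12Beta.OneLoopSplit`), the one-loop coefficients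
satisfy the drift hypothesis `|Σ_{j<k} β⁰_j − b k| ≤ A`, the remainder satisfies (AF-1) `|β¹_{k+1}(g_0,…,g_k)| ≤ C g_k`
on `]0,γ]`-histories, and `Cγ ≤ b`, then the partial sums of the β's along `]0,γ]`-histories are bounded below by
`−2A`: `FlowStepRuns.BetaPartialSumsLowerH (2A) γ β` — the exact endpoint hypothesis of `FlowStepRuns` §7, with NO
hypothesis on the sign of any individual `β⁰_{k+1}` and no convergence hypothesis.  Bookkeeping; nothing of the series
is asserted. [cite: Balaban1987RG1, Thm 2 p.259 (first sentence) and (2.12)–(2.14) p.268] -/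
theorem betaPartialSumsLowerH_of_drift {β : HBeta} (S : B12Beta.OneLoopSplit β) {b A Cr γ : ℝ}
    (hdrift : OneLoopDrift b A S.β0)
    (hAF1 : ∀ k (p : Fin (k + 1) → ℝ), p ∈ B12Beta.HistBox γ k → |S.β1 k p| ≤ Cr * p (Fin.last k))
    (hCr : 0 ≤ Cr) (hγ : Cr * γ ≤ b) :
    BetaPartialSumsLowerH (2 * A) γ β := by
  intro g hg k n hkn
  have hstep : ∀ j, S.β0 j - b ≤ β j (prefixOf g j) := fun j => by
    have hp : prefixOf g j ∈ B12Beta.HistBox γ j := fun i => hg i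
    have h2 := abs_le.mp (hAF1 j _ hp)
    have hlast : Cr * prefixOf g j (Fin.last j) ≤ Cr * γ :=
      mul_le_mul_of_nonneg_left (hp (Fin.last j)).2 hCr
    rw [S.split j]
    linarith [h2.1]
  have hsum : ∑ j ∈ Finset.Ico k n, (S.β0 j - b) ≤ ∑ j ∈ Finset.Ico k n, β j (prefixOf g j) :=
    Finset.sum_le_sum fun j _ => hstep j
  have hsplit : ∑ j ∈ Finset.Ico k n, (S.β0 j - b) = ∑ j ∈ Finset.Ico k n, S.β0 j - b * ((n : ℝ) - k) := by
    rw [Finset.sum_sub_distrib, Finset.sum_const, Nat.card_Ico, nsmul_eq_mul, Nat.cast_sub hkn]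
    ring
  have hdr := sum_Ico_ge_of_drift hdrift hkn
  have hnk : (0 : ℝ) ≤ (n : ℝ) - k := by
    have : (k : ℝ) ≤ n := by exact_mod_cast hkn
    linarith
  have hb : 0 ≤ b := le_trans (mul_nonneg hCr (le_trans (le_of_lt (hg 0).1) (hg 0).2)) hγ
  have hbnk : 0 ≤ b * ((n : ℝ) - k) := mul_nonneg hb hnk
  linarith

/-- **The limit form is a drift.**  Geometric convergence `|β0 k − β∞| ≤ c₀θ^k` (`0 ≤ θ < 1`, `0 ≤ c₀`) gives the drift
hypothesis with `b = β∞`, `A = c₀/(1−θ)`; so `FlowStepRuns.betaPartialSumsLowerH_of_limitSplit` (§10 there) is the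
special case of `betaPartialSumsLowerH_of_drift` up to the constant `2A` versus `A`. [folklore] -/
theorem drift_of_geometric {β0 : ℕ → ℝ} {binf c₀ θ : ℝ} (hθ0 : 0 ≤ θ) (hθ1 : θ < 1) (hc₀ : 0 ≤ c₀)
    (hconv : ∀ k, |β0 k - binf| ≤ c₀ * θ ^ k) : OneLoopDrift binf (c₀ / (1 - θ)) β0 := by
  intro k
  have h1 : ∑ j ∈ Finset.range k, β0 j - binf * k = ∑ j ∈ Finset.range k, (β0 j - binf) := by
    rw [Finset.sum_sub_distrib, Finset.sum_const, Finset.card_range, nsmul_eq_mul]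
    ring
  have h1θ : 0 < 1 - θ := by linarith
  have hgeom : ∑ j ∈ Finset.range k, θ ^ j ≤ 1 / (1 - θ) := by
    have := geom_sum_Ico_le_of_lt_one hθ0 hθ1 (m := 0) (n := k)
    rw [pow_zero, ← Finset.range_eq_Ico] at this
    exact this
  rw [h1]
  calc |∑ j ∈ Finset.range k, (β0 j - binf)|
        ≤ ∑ j ∈ Finset.range k, |β0 j - binf| := Finset.abs_sum_le_sum_abs _ _
    _ ≤ ∑ j ∈ Finset.range k, c₀ * θ ^ j := Finset.sum_le_sum fun j _ => hconv j
    _ = c₀ * ∑ j ∈ Finset.range k, θ ^ j := (Finset.mul_sum _ _ _).symm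
    _ ≤ c₀ * (1 / (1 - θ)) := mul_le_mul_of_nonneg_left hgeom hc₀
    _ = c₀ / (1 - θ) := mul_one_div c₀ (1 - θ)

/-- A drift with `b > 0` makes the window sums eventually POSITIVE and growing: for `n ≥ k + ⌈(2A + 1)/b⌉`-type
separations, concretely whenever `2A < b (n − k)`, one has `0 < Σ_{j∈[k,n)} β0 j`.  (So the drift form still carries
"asymptotic freedom on average", while saying nothing about individual signs.) [folklore] -/
theorem sum_Ico_pos_of_drift {b A : ℝ} {β0 : ℕ → ℝ} (h : OneLoopDrift b A β0) {k n : ℕ} (hkn : k ≤ n)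
    (hsep : 2 * A < b * ((n : ℝ) - k)) : 0 < ∑ j ∈ Finset.Ico k n, β0 j := by
  have := sum_Ico_ge_of_drift h hkn
  linarith

/-- **Endpoint existence from the drift form** (forward-generated constructions): drift + (AF-1) with `Cγ₀ ≤ b`, the
printed upper bound and continuity suffice — no small-k signs, no convergence of `β⁰_{k+1}`.
[cite: Balaban1987RG1, Thm 2 p.259 (first sentence) and (2.12)–(2.14) p.268] -/
theorem endpointExistence_of_drift {C : B12.Construction} {β : HBeta} (hgen : DagBinding.ForwardGenerated C β)
    (S : B12Beta.OneLoopSplit β) {γ₀ b A Cr β' : ℝ} (hγ₀ : 0 < γ₀)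
    (hdrift : OneLoopDrift b A S.β0)
    (hAF1 : ∀ k (p : Fin (k + 1) → ℝ), p ∈ B12Beta.HistBox γ₀ k → |S.β1 k p| ≤ Cr * p (Fin.last k))
    (hCr : 0 ≤ Cr) (hγ : Cr * γ₀ ≤ b) (hβ' : 0 ≤ β') (hcont : BetaContH γ₀ β) (hup : BetaUpperH β' γ₀ β) :
    DagBinding.EndpointExistence C :=
  endpointExistence_of_partialSums hgen hγ₀ (by linarith [hdrift.nonneg]) hβ' hcont
    (betaPartialSumsLowerH_of_drift S hdrift hAF1 hCr hγ) hup

/-- **The p. 355 unconditional reading from the drift form**: `B16.Sect2Unconditional` and (0.1) with a bare coupling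
for every renormalised `g ≤ g⋆`, from the cell's `World` bookkeeping, the modelling clauses, the DRIFT form of the
one-loop split with `Cγ₀ ≤ b`, the printed upper bound, continuity, and the smallness `2A·γ² ≤ β₀(2+β₀)` of the
volume constant.  Bookkeeping only. [cite: Balaban1989LargeFieldII, p.355; Balaban1987RG1, (2.12)–(2.14) p.268] -/
theorem p355Unconditional_of_drift (w : World) (hγw : 0 < w.γ) {γ₀ : ℝ} (hγ₀ : w.γ ≤ γ₀)
    (hβup : 0 ≤ w.βup) (hnodes : ∀ P, Nodes (leaves w P)) {β : HBeta}
    (hgen : DagBinding.ForwardGenerated w.C.toB12 β) (hhalt : HaltsOutside w.C.toB12 β)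
    (hcur : DagBinding.CurriesHBeta w.C.toB12 β) (hcont : BetaContH γ₀ β) (hup : BetaUpperH w.βup γ₀ β)
    (S : B12Beta.OneLoopSplit β) {b A Cr : ℝ} (hdrift : OneLoopDrift b A S.β0)
    (hAF1 : ∀ k (p : Fin (k + 1) → ℝ), p ∈ B12Beta.HistBox γ₀ k → |S.β1 k p| ≤ Cr * p (Fin.last k))
    (hCr : 0 ≤ Cr) (hγ : Cr * γ₀ ≤ b) (hMγ : 2 * A * w.γ ^ 2 ≤ w.β₀ * (2 + w.β₀)) :
    B16.Sect2Unconditional w.C ∧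
      ∃ Em Ep : ℝ, ∀ m : ℕ, ∃ gstar : ℝ, 0 < gstar ∧ ∀ g : ℝ, 0 < g → g ≤ gstar →
        ∀ K : ℕ, ∃ g0 : ℝ, (w.C ⟨K, m, g0⟩).flow.g K = g ∧
          ∀ k, k ≤ K → ∀ V : (w.C ⟨K, m, g0⟩).Cfg k, B16.UVIneq (w.C ⟨K, m, g0⟩) k V Em Ep :=
  p355Unconditional_of_partialSums w hγw hγ₀ (by linarith [hdrift.nonneg]) hβup hMγ hnodes hgen hhalt hcur hcont
    (betaPartialSumsLowerH_of_drift S hdrift hAF1 hCr hγ) hup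

end Literature.MathematicalPhysics.QuantumFieldTheory.Balaban1983to89.Beta.Drift
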